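/-
Copyright (c) 2026 the pub-hodgecm-mathlib formalisation cell (harness21).  Prover seat hodgecm-mathlib-K2E3-p05 (g0), Track B «K2-LIT»,
engine E3 «EllipticInputs», unit U4 «Keys», 2026-09-03.  KERNEL module: THEOREMS ONLY (no definition, no named fact, no `sorry`,
no instance, no notation).
-/
import Summits.HodgeConjecture.HodgeConjecture.Theorems.F0P3cStCharTSPSIrredRegular                  -- ★ Bruhat: `cmWeylTorusCharPair_eq_of_ne_bot_ne_top` (reducible UNITARY `i_G(χ)` is `w`-fixed)
import HarnessLib

/-!
# K2 ∕ E3 «EllipticInputs», unit U4 «Keys» — tier-0 stub 4 `stub_keysReducibleList` (hKeysRed, Keys' list (1)(2)(3), direction ⇒) DOCKED on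
# [Keys1984, §7 Theorem (2)] (non-unitary points, PRINT) + socket #6 `sig_K2E3IrregularReducibleCaseThree` (Keys' Theorem (1), the `w`-fixed
# unitary case) + ★ Bruhat — sockets #4, #5 (the intertwining-composition road) are not needed for the stub

Cell hodgecm-mathlib (D-0151), FLOOR 0, Track B «K2-LIT» (21-frontier RULING «PUSH BOTH», REQUESTS l.72341), engine E3, crux item H413 =
stmt-HodgeConjecture-24833 (route `HCCMUnconditional`, no route verbs); tier 0 `Cruxes/H413/Lines/K2_E3_EllipticInputs.lean` (c332c4f23d348f81) :139–:141,
tier-1 socket module `Cruxes/H413/Lines/K2_E3_EllipticInputsSigs_U4Keys.lean` (fb4ac27b21583d86) :93–:98.  Author K2E3-p05 (g0), companion of ★-filed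
`Theorems/K2E3CompZeroKeysListRegularOfKeysThmTwo` (p854986).  `--supports stmt-HodgeConjecture-24833 --as helper`; THEOREMS ONLY; never imports `Cruxes/…/Lines`
(statement bytes pasted, the Lines-side `abbrev Pl L := HeightOneSpectrum (𝓞 L⁺)` inlined).

THE MATHEMATICS.  `G = U(Φ₃)(L⁺_v)`, `v` non-split, `χ = (χ₁, χ₂)` continuous, `i_G(χ)` with a `G`-stable `⊥ ≠ N ≠ ⊤`.  Case split on `|χ₁| = 1`:
* `χ₁` UNITARY: ★ Bruhat (`F0P3cStCharTSPSIrredRegular.cmWeylTorusCharPair_eq_of_ne_bot_ne_top`, [Casselman1995 Thm. 6.6.1]) gives `wχ = χ`; then socket #6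
  (= [Keys1984 §7 Thm (1)]: «the unitary principal series `Ind_P^G λ` is reducible iff `λ ≠ 1`, `wλ = λ`, `λ|_{F^×} = 1`», direction ⇒, typed at `wχ = χ`)
  yields disjunct (3): `χ₁ ≠ 1 ∧ χ₁|_{F^×} = 1`.
* `χ₁` NOT unitary: [Keys1984 §7 Thm (2)] = [Rogawski1990 §12.2 (1)–(2)] (hypothesis `hK`, the bytes of ★-filed `compZeroKeysListRegular_of_keysThmTwo`'s
  hypothesis) yields disjunct (1) or (2).
So **stub 4 ⟸ [Keys Thm (2)] + socket #6 + ★**: the tier-1 composition `keysReducibleList_of_sigs` (#4 Casselman ⇒, #5 `γ(χ)` zero-set, #6) can be re-cut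
with ONE print socket for the non-unitary points; #4∕#5 (and their servants #7∕#8) then carry no weight toward stub 4 (they remain true and useful
statements — Casselman's criterion and `dim Hom ≤ 1` — for whoever formalises Keys' `c`-function proof of Thm (2)).  Nothing printed is discharged here.

* §1 `keysReducibleList_of_keysThmTwo_of_irregularCaseThree (hK) (h6) : ‹bytes of stub_keysReducibleList›`.
Tie probes (home, import the two Lines modules; wait on their farm builds): `example (hK) (h6 : type_of% @…U4Keys.sig_K2E3IrregularReducibleCaseThree) :
type_of% @…K2E3EllipticInputs.stub_keysReducibleList := keysReducibleList_of_keysThmTwo_of_irregularCaseThree hK h6`.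
HONEST LABEL: HC_CM is proved only modulo the 7 printed citations (2 remaining named inputs: hLiu418 = stmt-HodgeConjecture-24832, h413 =
stmt-HodgeConjecture-24833) until rung 0 closes; this file discharges no printed citation (docking glue over ★ + two hypotheses).

## References
* [Keys1984] D. Keys, *Principal series representations of special unitary groups over local fields*, Compositio Math. 51 (1984) 115–130: §7 Theorem (1)–(2) p. 126.
* [Rogawski1990] J. D. Rogawski, *Automorphic Representations of Unitary Groups in Three Variables*, Ann. of Math. Stud. 123 (1990), §12.2 (1)–(3) p. 173.
* [Casselman1995] W. Casselman, *Introduction to the theory of admissible representations of p-adic reductive groups* (draft 1995), §6.6 Thm. 6.6.1 (Bruhat).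
-/

set_option autoImplicit false
-- the mandated namespace has the single-problem summit's repeated segment (`HodgeConjecture.HodgeConjecture`)
set_option linter.dupNamespace false

noncomputable section

open NumberField IsDedekindDomain MeasureTheory
open scoped Matrix MatrixGroups NNReal
open Literature.NumberTheory.Automorphic Literature.NumberTheory.Automorphic.UnitaryGroup

namespace Summit.HodgeConjecture.HodgeConjecture.Cruxes.H413.K2E3KeysReducibleListOfKeysThmTwo

set_option synthInstance.maxHeartbeats 400000 in
set_option maxHeartbeats 1600000 in
-- statement-heavy: the `SmoothInd` carrier of `cmPrincipalSeries` (same budget as the socket module)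
/-- **Tier-0 stub 4 `stub_keysReducibleList` FROM [Keys1984 §7 Thm (2)] + socket #6 + ★ Bruhat.**  `hK` = Keys' Theorem (2) ∕ [Rogawski1990 §12.2 (1)–(2)]
in the organ's vocabulary (a reducible `i_G(χ₁, χ₂)` with `χ₁` NOT unitary has `χ₁ = ‖·‖^{±1}` or `χ₁ = η‖·‖^{±1/2}`, `η|_{F^×} = ω_{E/F}`); `h6` = the bytes of
socket #6 `sig_K2E3IrregularReducibleCaseThree` ([Keys1984 §7 Thm (1)] ⇒ at `wχ = χ`); conclusion = the bytes of `stub_keysReducibleList` (Keys' list (1) ∨ (2) ∨ (3)).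
Proof: if `|χ₁| = 1`, ★ `cmWeylTorusCharPair_eq_of_ne_bot_ne_top` gives `wχ = χ` and `h6` gives (3); otherwise `hK` gives (1) ∨ (2).
[cite: Keys1984, §7 Theorem (1)–(2) p. 126] [cite: Rogawski1990, §12.2 (1)–(3) p. 173] [cite: Casselman1995, Thm. 6.6.1] -/
theorem keysReducibleList_of_keysThmTwo_of_irregularCaseThree
    (hK : ∀ (L : Type) [Field L] [NumberField L] [IsCMField L] (v : HeightOneSpectrum (𝓞 ↥(maximalRealSubfield L))),
      (∀ w : PlacesOver L v, IsCMField.complexConj L • w.1 = w.1) →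
      ∀ (χ₁ : (UnitaryGroup.LocalRing L v)ˣ →* ℂˣ) (χ₂ : ↥(normOneUnits (conjLocal L (IsCMField.complexConj L) v)) →* ℂˣ),
      Continuous (fun x => ((χ₁ x : ℂˣ) : ℂ)) → Continuous (fun x => ((χ₂ x : ℂˣ) : ℂ)) → (∃ x, ‖((χ₁ x : ℂˣ) : ℂ)‖ ≠ 1) →
      (∃ N : Subrepresentation (UnitaryGroup.cmPrincipalSeries L 3 v (UnitaryGroup.cmTorusCharPair L v χ₁ χ₂)), N ≠ ⊥ ∧ N ≠ ⊤) →
      (χ₁ = halfModulusChar (UnitaryGroup.LocalRing L v) * halfModulusChar (UnitaryGroup.LocalRing L v) ∨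
      χ₁ = (halfModulusChar (UnitaryGroup.LocalRing L v) * halfModulusChar (UnitaryGroup.LocalRing L v))⁻¹) ∨
      (∃ η : (UnitaryGroup.LocalRing L v)ˣ →* ℂˣ, IsQuadraticCharExtension (conjLocal L (IsCMField.complexConj L) v) η ∧
      Continuous (fun x => ((η x : ℂˣ) : ℂ)) ∧
      (χ₁ = η * halfModulusChar (UnitaryGroup.LocalRing L v) ∨ χ₁ = η * (halfModulusChar (UnitaryGroup.LocalRing L v))⁻¹)))
    (h6 : ∀ (L : Type) [Field L] [NumberField L] [IsCMField L] (v : HeightOneSpectrum (𝓞 ↥(maximalRealSubfield L))),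
      (∀ w : PlacesOver L v, IsCMField.complexConj L • w.1 = w.1) →
      ∀ (χ₁ : (UnitaryGroup.LocalRing L v)ˣ →* ℂˣ) (χ₂ : ↥(normOneUnits (conjLocal L (IsCMField.complexConj L) v)) →* ℂˣ), Continuous (fun x => ((χ₁ x : ℂˣ) : ℂ)) → Continuous (fun x => ((χ₂ x : ℂˣ) : ℂ)) → UnitaryGroup.cmTorusCharPair L v χ₁ χ₂ = UnitaryGroup.cmTorusCharPair L v (UnitaryGroup.conjInvChar (conjLocal L (IsCMField.complexConj L) v) χ₁) χ₂ →
      (∃ N : Subrepresentation (UnitaryGroup.cmPrincipalSeries L 3 v (UnitaryGroup.cmTorusCharPair L v χ₁ χ₂)), N ≠ ⊥ ∧ N ≠ ⊤) →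
      (χ₁ ≠ 1 ∧ ∀ a : (UnitaryGroup.LocalRing L v)ˣ, (conjLocal L (IsCMField.complexConj L) v) (a : UnitaryGroup.LocalRing L v) = a → χ₁ a = 1)) :
    ∀ (L : Type) [Field L] [NumberField L] [IsCMField L] (v : HeightOneSpectrum (𝓞 ↥(maximalRealSubfield L))),
    (∀ w : PlacesOver L v, IsCMField.complexConj L • w.1 = w.1) →
    (∀ (χ₁ : (UnitaryGroup.LocalRing L v)ˣ →* ℂˣ) (χ₂ : ↥(normOneUnits (conjLocal L (IsCMField.complexConj L) v)) →* ℂˣ), Continuous (fun x => ((χ₁ x : ℂˣ) : ℂ)) → Continuous (fun x => ((χ₂ x : ℂˣ) : ℂ)) → (∃ N : Subrepresentation (UnitaryGroup.cmPrincipalSeries L 3 v (UnitaryGroup.cmTorusCharPair L v χ₁ χ₂)), N ≠ ⊥ ∧ N ≠ ⊤) → (χ₁ = halfModulusChar (UnitaryGroup.LocalRing L v) * halfModulusChar (UnitaryGroup.LocalRing L v) ∨ χ₁ = (halfModulusChar (UnitaryGroup.LocalRing L v) * halfModulusChar (UnitaryGroup.LocalRing L v))⁻¹) ∨ (∃ η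 : (UnitaryGroup.LocalRing L v)ˣ →* ℂˣ, IsQuadraticCharExtension (conjLocal L (IsCMField.complexConj L) v) η ∧ Continuous (fun x => ((η x : ℂˣ) : ℂ)) ∧ (χ₁ = η * halfModulusChar (UnitaryGroup.LocalRing L v) ∨ χ₁ = η * (halfModulusChar (UnitaryGroup.LocalRing L v))⁻¹)) ∨ (χ₁ ≠ 1 ∧ ∀ a : (UnitaryGroup.LocalRing L v)ˣ, (conjLocal L (IsCMField.complexConj L) v) (a : UnitaryGroup.LocalRing L v) = a → χ₁ a = 1)) := by
  intro L _ _ _ v hns χ₁ χ₂ h₁ h₂ hred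
  by_cases hu : ∀ x, ‖((χ₁ x : ℂˣ) : ℂ)‖ = 1
  · -- unitary: ★ Bruhat ⇒ `wχ = χ`; socket #6 ⇒ disjunct (3)
    have hw : UnitaryGroup.cmWeylTorusCharPair L v χ₁ χ₂ = UnitaryGroup.cmTorusCharPair L v χ₁ χ₂ :=
      F0P3cStCharTSPSIrredRegular.cmWeylTorusCharPair_eq_of_ne_bot_ne_top L v hns χ₁ χ₂ h₁ h₂ hu hred
    have hfix : UnitaryGroup.cmTorusCharPair L v χ₁ χ₂ =
        UnitaryGroup.cmTorusCharPair L v (UnitaryGroup.conjInvChar (conjLocal L (IsCMField.complexConj L) v) χ₁) χ₂ :=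
      ((UnitaryGroup.cmWeylTorusCharPair_eq L v χ₁ χ₂).symm.trans hw).symm
    exact Or.inr (Or.inr (h6 L v hns χ₁ χ₂ h₁ h₂ hfix hred))
  · -- non-unitary: [Keys1984 §7 Thm (2)] ⇒ disjunct (1) or (2)
    push Not at hu
    rcases hK L v hns χ₁ χ₂ h₁ h₂ hu hred with h | h
    · exact Or.inl h
    · exact Or.inr (Or.inl h)

end Summit.HodgeConjecture.HodgeConjecture.Cruxes.H413.K2E3KeysReducibleListOfKeysThmTwo

end
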